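import Summits.BirchSwinnertonDyer.BirchSwinnertonDyer.Theorems.SchneiderFreeAdditiveX3CanonicalLinePotMult
import Summits.BirchSwinnertonDyer.BirchSwinnertonDyer.Theses.SchneiderFreeAdditiveX3
import HarnessLib

/-!
# Crux r5 `LocalTowerTorsionFiniteX3` (stmt-BirchSwinnertonDyer-19546) modulo exactly
# {the CFT fact, A41, the (G-ord, `e = 2`) half} — the (M) half discharged

Seat `bsd-schneider-door-c2` (cell `bsd-schneider-ideate`), gen 5; route `SchneiderFreeAdditiveX3`; sequel
of `…CanonicalLinePotMult`.  The crux decl quantifies over the semistable-twist cell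
`SubSemistableTwist = SubM ∨ SubGordTwo`; its skeleton «by cell» has the two registered stubs
`stub_finV_potMult` / `stub_finV_gordTwo`.  With `stub_finV_potMult_of_facts` (this seat, from the CFT
fact (i) and the published Tate uniformisation A41) the crux is, BY NAME, a consequence of
(i) + A41 + the (G-ord, `e = 2`) stub — `localTowerTorsionFiniteX3_of_facts_of_stub_gordTwo` — or of
(i) + A41 + hypothesis (ii) «canonical line with its character» on `SubGordTwo` alone (door-c5's
`stub_finV_gordTwo_of_lineCharacter`) — `localTowerTorsionFiniteX3_of_facts_of_lineCharacter_gordTwo`.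
Typed record for the planner's F2-class re-typing of item 19546 (RECIPE-FinV-F2): the (M) cell
contributes NO residual beyond the two published inputs.  Proofs only (no definition, no named fact,
no `sorry`); helper for stmt-BirchSwinnertonDyer-19546; the crux stays OPEN (the (G-ord, `e = 2`) half of
(ii) is not in the tree); BSD is not advanced.

References: [JetchevSkinnerWan2017] §3.3 Prop. 3.3.4 Case 3(b); [SilvermanATAEC1994] Ch. V 5.2–5.4.
-/

noncomputable section

open scoped Classical

namespace Summit.BirchSwinnertonDyer.BirchSwinnertonDyer.Theorems.SchneiderFreeAdditiveX3

open NumberField IsDedekindDomain Field WeierstrassCurve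
  Literature.NumberTheory.EllipticCurves Literature.NumberTheory.EllipticCurves.GreenbergSelmer
  Literature.NumberTheory.GaloisRepresentations
  Summit.BirchSwinnertonDyer.Rank1Residual

set_option linter.dupNamespace false

/-- **Crux r5 from the facts and the (G-ord, `e = 2`) STUB.**  `LocalTowerTorsionFiniteX3` follows
from (i) the CFT fact `ZpExtension.exists_isFrobPow_mem_kerSubgroup_of_isAnticyclotomic`, A41
`Silverman1994_thmV53_corV54_tateUniformisation`, and the registered stub `stub_finV_gordTwo`
(signature verbatim as the third hypothesis): case split `SubSemistableTwist = SubM ∨ SubGordTwo`,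
the (M) case by `stub_finV_potMult_of_facts`.  CONDITIONAL (typed record; the crux stays open).
[cite: JetchevSkinnerWan2017, §3.3 Prop. 3.3.4 Case 3(b), Remark 3.3.5 (arXiv:1512.06894 p. 13)] -/
theorem localTowerTorsionFiniteX3_of_facts_of_stub_gordTwo
    (hCFT : ∀ (K : Type) [Field K] [NumberField K] (p : ℕ) [Fact p.Prime],
      ZpExtension.exists_isFrobPow_mem_kerSubgroup_of_isAnticyclotomic K p)
    (hT : Silverman1994_thmV53_corV54_tateUniformisation.{0})
    (hG : ∀ (W : WeierstrassCurve ℚ) [W.IsElliptic] [W.IsGloballyMinimal] (p : ℕ) [Fact p.Prime],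
      W.analyticRank = 1 → p ≠ 2 → Literature.NumberTheory.EllipticCurves.Rank1Residual.ClassX3 W p →
        Summit.BirchSwinnertonDyer.Rank1Residual.Additive.SubGordTwo W p →
        (∀ (K : Type) [Field K] [NumberField K],
          Literature.NumberTheory.EllipticCurves.IsImaginaryQuadratic K →
          Summit.BirchSwinnertonDyer.Rank1Residual.X11b.SplitsIn K p →
          ∀ (κ : Literature.NumberTheory.EllipticCurves.ZpExtension K p), κ.IsAnticyclotomic →
          ∀ (𝔭 : IsDedekindDomain.HeightOneSpectrum (NumberField.RingOfIntegers K)),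
            ((p : ℕ) : NumberField.RingOfIntegers K) ∈ 𝔭.asIdeal →
            (FixedPoints.addSubgroup ↥(Literature.NumberTheory.EllipticCurves.GreenbergSelmer.decomp 𝔭 ⊓
              κ.kerSubgroup) ((W.baseChange K).geomPrimaryTorsion p) :
            Set ((W.baseChange K).geomPrimaryTorsion p)).Finite)) :
    Summit.BirchSwinnertonDyer.BirchSwinnertonDyer.Theses.SchneiderFreeAdditiveX3.LocalTowerTorsionFiniteX3 := by
  intro W _ _ p _ hr hp2 hX hcell K _ _ hK hsplit κ hκ 𝔭 h𝔭
  rcases hcell with hM | hG2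
  · exact stub_finV_potMult_of_facts hCFT hT W p hr hp2 hX hM K hK hsplit κ hκ 𝔭 h𝔭
  · exact hG W p hr hp2 hX hG2 K hK hsplit κ hκ 𝔭 h𝔭

/-- **Crux r5 from the facts and hypothesis (ii) on the (G-ord, `e = 2`) cell alone.**
`LocalTowerTorsionFiniteX3` follows from (i) the CFT fact, A41, and «the canonical line with its
character» on `SubGordTwo` (the hypothesis `hLine` of door-c5's `stub_finV_gordTwo_of_lineCharacter`,
verbatim) — the ONE residual input of the control corner's Fin_v atom after this seat's (M) discharge.
CONDITIONAL (typed record; the crux stays open).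
[cite: JetchevSkinnerWan2017, §3.3 Prop. 3.3.4 Case 3(b), Remark 3.3.5 (arXiv:1512.06894 p. 13)] -/
theorem localTowerTorsionFiniteX3_of_facts_of_lineCharacter_gordTwo
    (hCFT : ∀ (K : Type) [Field K] [NumberField K] (p : ℕ) [Fact p.Prime],
      ZpExtension.exists_isFrobPow_mem_kerSubgroup_of_isAnticyclotomic K p)
    (hT : Silverman1994_thmV53_corV54_tateUniformisation.{0})
    (hLine : ∀ (W : WeierstrassCurve ℚ) [W.IsElliptic] [W.IsGloballyMinimal] (p : ℕ) [Fact p.Prime],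
      W.analyticRank = 1 → p ≠ 2 → Literature.NumberTheory.EllipticCurves.Rank1Residual.ClassX3 W p →
        Summit.BirchSwinnertonDyer.Rank1Residual.Additive.SubGordTwo W p →
        ∀ (K : Type) [Field K] [NumberField K], IsImaginaryQuadratic K → X11b.SplitsIn K p →
          ∀ (𝔭 : HeightOneSpectrum (𝓞 K)), ((p : ℕ) : 𝓞 K) ∈ 𝔭.asIdeal →
          ∃ (C : AddSubgroup ((W.baseChange K).geomPrimaryTorsion p)) (a : ℤ) (α : ℤ_[p]ˣ),
            (∀ d ∈ decomp 𝔭, ∀ c ∈ C, d • c ∈ C) ∧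
            Set.ncard {c : (W.baseChange K).geomPrimaryTorsion p | c ∈ C ∧ p • c = 0} ≤ p ∧
            (∀ k : ℕ, ∃ c ∈ C, addOrderOf c = p ^ k) ∧
            (∃ τ ∈ decomp 𝔭, ∀ m : (W.baseChange K).geomPrimaryTorsion p, τ • m + m ∈ C) ∧
            ((α : ℤ_[p])) ^ 2 = a * (α : ℤ_[p]) - p ∧
            (∀ (σ : absoluteGaloisGroup (𝔭.adicCompletion K)) (n : ℕ), IsFrobPow σ (n : ℤ) →
              ∃ s : ℤ, (s = 1 ∨ s = -1) ∧
                ∀ (k : ℕ) (c : (W.baseChange K).geomPrimaryTorsion p), c ∈ C → p ^ k • c = 0 →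
                  ∀ N : ℤ, ((N : ℤ_[p]) - s *
                      ((GaloisRep.cyclotomicCharacter K p
                          (absGaloisRestrict K (𝔭.adicCompletion K) σ) * (α⁻¹) ^ n : ℤ_[p]ˣ) :
                        ℤ_[p]) ∈ (Ideal.span {(p : ℤ_[p]) ^ k} : Ideal ℤ_[p])) →
                    absGaloisRestrict K (𝔭.adicCompletion K) σ • c = N • c)) :
    Summit.BirchSwinnertonDyer.BirchSwinnertonDyer.Theses.SchneiderFreeAdditiveX3.LocalTowerTorsionFiniteX3 :=
  localTowerTorsionFiniteX3_of_facts_of_stub_gordTwo hCFT hT (stub_finV_gordTwo_of_lineCharacter hCFT hLine)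

/-! ## Appendix (gen 5): the registered stub `stub_lineDatum_potMult` of skeleton «moving-line» -/

/-- **Registered stub `stub_lineDatum_potMult` of crux r5's skeleton «moving-line» (P2 g10, rev 11) modulo
A41** — signature verbatim as the conclusion: on the (M) cell, at every `K` imaginary quadratic with `p` split
and `𝔭 ∣ p`, a line datum `(C, τ)` — `τ ∈ D_𝔭` stabilising `C`, acting as `−1` modulo `C`, `#C[p] ≤ p`.  It
is the character-free shadow of `lineCharacter_subM` (the Tate line of the multiplicative `p*`-twist
model at `(K, 𝔭)`; `τ ∈ D_𝔭` and `C` is `D_𝔭`-stable).  CONDITIONAL on the published Tate uniformisation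
A41 only. [cite: SilvermanATAEC1994, Ch. V Lemma 5.2 (c), Thm. 5.3 (a),(b), Cor. 5.4 (held copy PDF pp. 406–410)] -/
theorem stub_lineDatum_potMult_of_tate (hT : Silverman1994_thmV53_corV54_tateUniformisation.{0}) :
    ∀ (W : WeierstrassCurve ℚ) [W.IsElliptic] [W.IsGloballyMinimal] (p : ℕ) [Fact p.Prime],
      W.analyticRank = 1 → p ≠ 2 → Literature.NumberTheory.EllipticCurves.Rank1Residual.ClassX3 W p →
        Summit.BirchSwinnertonDyer.Rank1Residual.Additive.SubM W p →
        ∀ (K : Type) [Field K] [NumberField K], Literature.NumberTheory.EllipticCurves.IsImaginaryQuadratic K →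
          Summit.BirchSwinnertonDyer.Rank1Residual.X11b.SplitsIn K p →
          ∀ (𝔭 : IsDedekindDomain.HeightOneSpectrum (NumberField.RingOfIntegers K)),
            ((p : ℕ) : NumberField.RingOfIntegers K) ∈ 𝔭.asIdeal →
            ∃ (C : AddSubgroup ((W.baseChange K).geomPrimaryTorsion p)) (τ : Field.absoluteGaloisGroup K),
              τ ∈ Literature.NumberTheory.EllipticCurves.GreenbergSelmer.decomp 𝔭 ∧ (∀ c ∈ C, τ • c ∈ C) ∧
              (∀ m : ((W.baseChange K).geomPrimaryTorsion p), τ • m + m ∈ C) ∧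
              Set.ncard {c : ((W.baseChange K).geomPrimaryTorsion p) | c ∈ C ∧ p • c = 0} ≤ p := by
  intro W _ _ p _ hr hp2 hX hM K _ _ hK hsplit 𝔭 h𝔭
  obtain ⟨C, -, -, hCD, hcard, -, ⟨τ, hτD, hτ⟩, -, -⟩ := lineCharacter_subM hT W p hr hp2 hX hM K hK hsplit 𝔭 h𝔭
  exact ⟨C, τ, hτD, fun c hc ↦ hCD τ hτD c hc, hτ, hcard⟩

end Summit.BirchSwinnertonDyer.BirchSwinnertonDyer.Theorems.SchneiderFreeAdditiveX3

end
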